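import Summits.QuantumFields.YangMills.Theses.SquareRootCeilings
import Summits.QuantumFields.YangMills.Theorems.SquareRootCeilingsMirrorDominationRPCS
import HarnessLib

/-!
# Route `SquareRootCeilings`: the support `MirrorDomination` (stmt-QuantumFields-26792) — RP mirror domination

`AxisMirrorCeiling → SubOnsetTwoPointCeilings`: a two-point ceiling on the EXTREMAL one-parameter family (same
orientation `q`, separation `t·e_k` along one axis, `2R+2 ≤ t ≤ L`) dominates the covariance of every pair of
single-plane plaquette fields `P_q(x), P_q'(y)` on the odd torus `(ℤ/(2L+1))⁴` that are cyclically `(2R+4)`-separated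
in some coordinate `k`, with the SAME constant.  Mechanism (Osterwalder–Seiler 1978 §2; Fröhlich–Israel–Lieb–Simon 1978
Thm 2.1): move the axis `k` to the time axis by a coordinate permutation (the centred torus moments of plaquette
fields are hypercubic-invariant, tree `torusMomentStr_coordPerm`), translate the pair so that the site mirror `x₀ ↦ −x₀`
of the torus (which is at once the site reflection at `0` and the link reflection at the antipode `L + ½`) separates
them, and apply the reflection-positivity Cauchy–Schwarz inequality of the Wilson measure (tree
`Reflection.sq_cov_negReflect_le_odd_pos`): `Cov(P_q(x),P_q'(y))² ≤ c_q(d₁)·c_q'(d₂)` with on-axis same-orientation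
mirror covariances at separations `d₁, d₂ ∈ [g−1, g+2]`, `g ∈ [2R+4, L]` the cyclic gap; separations beyond `L` are
folded back by `c(t) = c(2L+1−t)` (periodicity + translation invariance + symmetry).

This file: §4 `abs_cov_le_of_axisMirror_zero` / `abs_cov_le_of_axisMirror` (the domination at fixed `β ≥ 0`, `L ≥ 4R+8`, any compact `G`, any lattice
representation) and `squareRootCeilings_mirrorDomination_proof : Theses.SquareRootCeilings.MirrorDomination`.
Width seat ym-line-sfw-p2-w2 g21 (free hands) for planner ym-idea-11.  No summit / leaf / NT statement is proved
here; `AxisMirrorCeiling` (stmt-QuantumFields-26791) stays OPEN.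
-/

set_option autoImplicit false

noncomputable section

open MeasureTheory Filter Topology
open Literature.MathematicalPhysics.QuantumFieldTheory Literature.MathematicalPhysics.QuantumLattice
open Literature.Probability.LatticeModels (Site)
open Summit.QuantumFields.YangMills.Cruxes.OSLegsFromFemtoAndGap.DlrCollarTransfer
open Summit.QuantumFields.YangMills.Theorems.OSLegsFromFemtoAndGap
  (torusE_comp_configShift torusE_plane_eq_wilsonTorusMean torusE_prod_plane_eq_torusMomentStr plane_torusLift
    permPlane permSites permPlane_valid torusMomentStr_coordPerm wilsonTorusMean_permPlane)
open Summit.QuantumFields.YangMills.Theorems.InfVolRP (reflSite reflSite_apply_zero reflSite_apply_of_ne plane_cfgReflect)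
open Summit.QuantumFields.YangMills.Cruxes.NT.ConjugateResponse (torusE_comp_cfgReflect cov_negReflect_self_nonneg)
open Summit.QuantumFields.YangMills.Cruxes.NT.MarkovMirror (dependsOn_posHalf_of_window)
open Summit.QuantumFields.YangMills.Cruxes.NT.Reflection (sq_cov_negReflect_le_odd_pos)

namespace Summit.QuantumFields.YangMills.Theorems.MirrorDomination

variable (G : Type) [Group G] [TopologicalSpace G] [IsTopologicalGroup G] [CompactSpace G]
  [MeasurableSpace G] [BorelSpace G] (r : LatticeRep G)

/-! ## §4 The domination along the time axis, and along any axis -/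

/-- Sum of two on-axis sites. -/
theorem axisSite_add (a b : ℤ) :
    ((fun i : Fin 4 => if i = 0 then a else 0) + fun i : Fin 4 => if i = 0 then b else 0) =
      fun i : Fin 4 => if i = 0 then a + b else 0 := by
  funext i
  by_cases hi : i = 0 <;> simp [hi]

/-- Integer multiples of an on-axis site. -/
theorem axisSite_zsmul (n b : ℤ) :
    n • (fun i : Fin 4 => if i = 0 then b else 0) = fun i : Fin 4 => if i = 0 then n * b else 0 := by
  funext i
  by_cases hi : i = 0 <;> simp [hi]

/-- **Folding the mirror separations**: the on-axis same-orientation covariance satisfies `c(t) = c(2L+1−t)`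
(periodicity, translation invariance, symmetry), so a ceiling on `[2R+2, L]` extends to `[2R+2, 2L+1−(2R+2)]`.
[folklore] -/
theorem abs_axisCov_le_ext (β : ℝ) {L R : ℕ} {B : ℝ}
    (hB : ∀ (q : Fin 4 × Fin 4) (t : ℕ), q.1 < q.2 → 2 * R + 2 ≤ t → t ≤ L →
      |torusE G r β L (fun U =>
          (plane G r q (fun i => if i = 0 then ((t : ℕ) : ℤ) else 0) U -
              torusE G r β L (plane G r q (fun i => if i = 0 then ((t : ℕ) : ℤ) else 0))) *
            (plane G r q (fun _ => 0) U - torusE G r β L (plane G r q (fun _ => 0))))| ≤ B)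
    (q : Fin 4 × Fin 4) (hq : q.1 < q.2) (t : ℕ) (ht : 2 * R + 2 ≤ t) (ht' : t + (2 * R + 2) ≤ 2 * L + 1) :
    |torusE G r β L (fun U =>
        (plane G r q (fun i => if i = 0 then ((t : ℕ) : ℤ) else 0) U -
            torusE G r β L (plane G r q (fun i => if i = 0 then ((t : ℕ) : ℤ) else 0))) *
          (plane G r q (fun _ => 0) U - torusE G r β L (plane G r q (fun _ => 0))))| ≤ B := by
  by_cases htL : t ≤ L
  · exact hB q t hq ht htL
  · -- fold: `t = (2L+1) − t'` with `2R+2 ≤ t' ≤ L`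
    push Not at htL
    obtain ⟨t', rfl⟩ : ∃ t' : ℕ, t = 2 * L + 1 - t' := ⟨2 * L + 1 - t, by omega⟩
    have ht'1 : 2 * R + 2 ≤ t' := by omega
    have ht'2 : t' ≤ L := by omega
    have key := hB q t' hq ht'1 ht'2
    -- c(2L+1−t') : rewrite the site as `−t' + (2L+1)·1`, use periodicity in the FIRST slot via symmetry
    have hsite : (fun i : Fin 4 => if i = 0 then (((2 * L + 1 - t' : ℕ) : ℕ) : ℤ) else 0) =
        (fun i : Fin 4 => if i = 0 then (-(t' : ℤ)) else 0) +
          ((2 * L + 1 : ℕ) : ℤ) • (fun i : Fin 4 => if i = 0 then (1 : ℤ) else 0) := by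
      rw [axisSite_zsmul, axisSite_add]
      funext i
      by_cases hi : i = 0
      · simp only [hi, ↓reduceIte, mul_one]
        push_cast
        omega
      · simp [hi]
    rw [hsite, cov_symm, cov_add_period, ← cov_translate G r β L q q (fun _ => 0)
      (fun i : Fin 4 => if i = 0 then (-(t' : ℤ)) else 0) (fun i : Fin 4 => if i = 0 then (t' : ℤ) else 0)]
    have h1 : ((fun _ : Fin 4 => (0 : ℤ)) + fun i : Fin 4 => if i = 0 then (t' : ℤ) else 0) =
        fun i : Fin 4 => if i = 0 then ((t' : ℕ) : ℤ) else 0 := by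
      funext i; by_cases hi : i = 0 <;> simp [hi]
    have h2 : ((fun i : Fin 4 => if i = 0 then (-(t' : ℤ)) else 0) + fun i : Fin 4 => if i = 0 then (t' : ℤ) else 0) =
        fun _ : Fin 4 => (0 : ℤ) := by
      funext i; by_cases hi : i = 0 <;> simp [hi]
    rw [h1, h2]
    exact key


/-- The mirror form of the reflection-positivity inequality is a centred two-point function. [folklore] -/
theorem mirrorForm_eq_cov (β : ℝ) (L : ℕ) (q : Fin 4 × Fin 4) (z : Site 4) :
    torusE G r β L (fun U => plane G r q (reflSite q z) U * plane G r q z U) - torusE G r β L (plane G r q z) ^ 2 =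
      torusE G r β L (fun U => (plane G r q (reflSite q z) U - torusE G r β L (plane G r q (reflSite q z))) *
        (plane G r q z U - torusE G r β L (plane G r q z))) := by
  rw [cov_eq_sub, torusE_plane_site G r β L q (reflSite q z) z, sq]

/-- The time coordinate of the reflected base site: `(reflSite q z) 0 = −z 0 − δ_q` with `δ_q ∈ {0, 1}`
(`δ_q = 1` iff the plaquette is electric, `q.1 = 0`). -/
theorem exists_reflSite_shift (q : Fin 4 × Fin 4) :
    ∃ δ : ℕ, δ ≤ 1 ∧ ∀ z : Site 4, reflSite q z 0 = -z 0 - (δ : ℤ) := by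
  by_cases h : q.1 = 0
  · exact ⟨1, le_rfl, fun z => by rw [reflSite_apply_zero, if_pos h]; norm_num⟩
  · exact ⟨0, zero_le_one, fun z => by rw [reflSite_apply_zero, if_neg h]; norm_num⟩

/-- **Mirror domination along the time axis.**  `β ≥ 0`, odd torus `2L+1` with `4R+8 ≤ L`, `1 ≤ R`; a ceiling `B`
on the on-axis same-orientation (mirror) covariances `|Cov(P_q(t e₀), P_q(0))| ≤ B` for `2R+2 ≤ t ≤ L` and every
orientation `q` dominates `|Cov(P_q(x), P_q'(y))|` for every pair whose time coordinates differ by `g` modulo `2L+1`,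
`2R+4 ≤ g ≤ L`.  Reflection positivity across the site mirror of the torus after a translation placing the pair at
times `−a−δ_q` and `b`, `a + b + δ_q = g`. [cite: FrohlichIsraelLiebSimon1978, Thm. 2.1; OsterwalderSeiler1978, §2] -/
theorem abs_cov_le_of_axisMirror_zero {β : ℝ} (hβ : 0 ≤ β) {L R : ℕ} (hR : 1 ≤ R) (hL : 4 * R + 8 ≤ L) {B : ℝ}
    (hB : ∀ (q : Fin 4 × Fin 4) (t : ℕ), q.1 < q.2 → 2 * R + 2 ≤ t → t ≤ L →
      |torusE G r β L (fun U =>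
          (plane G r q (fun i => if i = 0 then ((t : ℕ) : ℤ) else 0) U -
              torusE G r β L (plane G r q (fun i => if i = 0 then ((t : ℕ) : ℤ) else 0))) *
            (plane G r q (fun _ => 0) U - torusE G r β L (plane G r q (fun _ => 0))))| ≤ B)
    {q q' : Fin 4 × Fin 4} (hq : q.1 < q.2) (hq' : q'.1 < q'.2) (x y : Site 4) (g : ℕ) (hg : 2 * R + 4 ≤ g)
    (hgL : g ≤ L) (w : ℤ) (hxy : y 0 = x 0 + g + (2 * L + 1) * w) :
    |torusE G r β L (fun U => (plane G r q x U - torusE G r β L (plane G r q x)) *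
        (plane G r q' y U - torusE G r β L (plane G r q' y)))| ≤ B := by
  obtain ⟨δ, hδ1, hδ⟩ := exists_reflSite_shift q
  obtain ⟨δ', hδ'1, hδ'⟩ := exists_reflSite_shift q'
  -- the split `a + b + δ = g`
  set a : ℕ := (g - δ) / 2 with ha
  set b : ℕ := g - δ - a with hb
  have hab : a + b + δ = g := by omega
  have haL : (a : ℤ) + 2 ≤ (L : ℤ) := by omega
  have hbL : (b : ℤ) + 2 ≤ (L : ℤ) := by omega
  have hd1 : 2 * R + 2 ≤ 2 * a + δ := by omega
  have hd1L : 2 * a + δ ≤ L := by omega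
  have hd2 : 2 * R + 2 ≤ 2 * b + δ' := by omega
  have hd2L : 2 * b + δ' + (2 * R + 2) ≤ 2 * L + 1 := by omega
  -- the translated base points
  set xs : Site 4 := fun i => if i = 0 then (a : ℤ) else x i with hxs
  set ys : Site 4 := fun i => if i = 0 then (b : ℤ) else y i with hys
  have hxs0 : xs 0 = a := by simp [hxs]
  have hys0 : ys 0 = b := by simp [hys]
  have hX0 : reflSite q xs 0 = -(a : ℤ) - δ := by rw [hδ, hxs0]
  have hXi : ∀ i : Fin 4, i ≠ 0 → reflSite q xs i = x i := fun i hi => by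
    rw [reflSite_apply_of_ne q xs hi]; simp [hxs, hi]
  have hY0 : reflSite q' ys 0 = -(b : ℤ) - δ' := by rw [hδ', hys0]
  have hYi : ∀ i : Fin 4, i ≠ 0 → reflSite q' ys i = y i := fun i hi => by
    rw [reflSite_apply_of_ne q' ys hi]; simp [hys, hi]
  -- STEP 1: translate by `v := θxs − x` and remove the period in the second slot
  set v : Site 4 := reflSite q xs - x with hv
  have h1 : x + v = reflSite q xs := by rw [hv]; abel
  have h2 : y + v = ys + ((2 * L + 1 : ℕ) : ℤ) • (fun i : Fin 4 => if i = 0 then w else 0) := by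
    funext i
    simp only [hv, Pi.add_apply, Pi.sub_apply, Pi.smul_apply, smul_eq_mul]
    by_cases hi : i = 0
    · subst hi
      rw [hX0, hys0, hxy]
      simp only [↓reduceIte]
      push_cast
      have : (a : ℤ) + b + δ = g := by exact_mod_cast hab
      linarith
    · rw [hXi i hi]
      simp [hys, hi]
  have hmain : torusE G r β L (fun U => (plane G r q x U - torusE G r β L (plane G r q x)) *
        (plane G r q' y U - torusE G r β L (plane G r q' y))) =
      torusE G r β L (fun U => plane G r q (reflSite q xs) U * plane G r q' ys U) -
        torusE G r β L (plane G r q xs) * torusE G r β L (plane G r q' ys) := by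
    rw [← cov_translate G r β L q q' x y v, h1, h2, cov_add_period, cov_eq_sub,
      torusE_plane_site G r β L q (reflSite q xs) xs]
  -- STEP 2: reflection positivity
  obtain ⟨hcs, hM1, hM2⟩ := rpcs_plane G r hβ (L := L) (by omega) hq hq' xs ys (by rw [hxs0]; positivity)
    (by rw [hxs0]; exact haL) (by rw [hys0]; positivity) (by rw [hys0]; exact hbL)
  -- STEP 3: the two mirror forms are on-axis same-orientation covariances at separations `2a+δ`, `2b+δ'`
  have hM1eq : torusE G r β L (fun U => plane G r q (reflSite q xs) U * plane G r q xs U) -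
        torusE G r β L (plane G r q xs) ^ 2 =
      torusE G r β L (fun U =>
        (plane G r q (fun i => if i = 0 then (((2 * a + δ : ℕ) : ℕ) : ℤ) else 0) U -
            torusE G r β L (plane G r q (fun i => if i = 0 then (((2 * a + δ : ℕ) : ℕ) : ℤ) else 0))) *
          (plane G r q (fun _ => 0) U - torusE G r β L (plane G r q (fun _ => 0)))) := by
    have e1 : reflSite q xs + (-reflSite q xs) = fun _ => 0 := by
      funext i; simp
    have e2 : xs + (-reflSite q xs) = fun i => if i = 0 then (((2 * a + δ : ℕ) : ℕ) : ℤ) else 0 := by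
      funext i
      simp only [Pi.add_apply, Pi.neg_apply]
      by_cases hi : i = 0
      · subst hi; rw [hX0, hxs0]; simp only [↓reduceIte]; push_cast; ring
      · rw [hXi i hi]; simp [hxs, hi]
    rw [mirrorForm_eq_cov, ← cov_translate G r β L q q (reflSite q xs) xs (-reflSite q xs), e1, e2,
      cov_symm G r β L q q (fun _ => 0)]
  have hM2eq : torusE G r β L (fun U => plane G r q' (reflSite q' ys) U * plane G r q' ys U) -
        torusE G r β L (plane G r q' ys) ^ 2 =
      torusE G r β L (fun U =>
        (plane G r q' (fun i => if i = 0 then (((2 * b + δ' : ℕ) : ℕ) : ℤ) else 0) U -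
            torusE G r β L (plane G r q' (fun i => if i = 0 then (((2 * b + δ' : ℕ) : ℕ) : ℤ) else 0))) *
          (plane G r q' (fun _ => 0) U - torusE G r β L (plane G r q' (fun _ => 0)))) := by
    have e1 : reflSite q' ys + (-reflSite q' ys) = fun _ => 0 := by
      funext i; simp
    have e2 : ys + (-reflSite q' ys) = fun i => if i = 0 then (((2 * b + δ' : ℕ) : ℕ) : ℤ) else 0 := by
      funext i
      simp only [Pi.add_apply, Pi.neg_apply]
      by_cases hi : i = 0
      · subst hi; rw [hY0, hys0]; simp only [↓reduceIte]; push_cast; ring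
      · rw [hYi i hi]; simp [hys, hi]
    rw [mirrorForm_eq_cov, ← cov_translate G r β L q' q' (reflSite q' ys) ys (-reflSite q' ys), e1, e2,
      cov_symm G r β L q' q' (fun _ => 0)]
  -- STEP 4: the ceilings
  have hB1 : torusE G r β L (fun U => plane G r q (reflSite q xs) U * plane G r q xs U) -
        torusE G r β L (plane G r q xs) ^ 2 ≤ B := by
    rw [hM1eq]; exact (le_abs_self _).trans (hB q (2 * a + δ) hq hd1 hd1L)
  have hB2 : torusE G r β L (fun U => plane G r q' (reflSite q' ys) U * plane G r q' ys U) -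
        torusE G r β L (plane G r q' ys) ^ 2 ≤ B := by
    rw [hM2eq]; exact (le_abs_self _).trans (abs_axisCov_le_ext G r β hB q' hq' (2 * b + δ') hd2 hd2L)
  have hB0 : 0 ≤ B := hM1.trans hB1
  have hsq : (torusE G r β L (fun U => plane G r q (reflSite q xs) U * plane G r q' ys U) -
        torusE G r β L (plane G r q xs) * torusE G r β L (plane G r q' ys)) ^ 2 ≤ B ^ 2 := by
    rw [sq B]; exact hcs.trans (mul_le_mul hB1 hB2 hM2 hB0)
  rw [hmain]
  have := sq_le_sq.mp hsq
  rwa [abs_of_nonneg hB0] at this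


/-- **RP mirror domination (any axis).**  `β ≥ 0`, odd torus `(ℤ/(2L+1))⁴` with `4R+8 ≤ L`, `1 ≤ R`: a ceiling `B` on
the on-axis same-orientation mirror covariances `|Cov(P_q(t e₀), P_q(0))|`, `2R+2 ≤ t ≤ L` (all orientations `q`),
dominates `|Cov(P_q(x), P_q'(y))|` for EVERY pair of single-plane fields cyclically `(2R+4)`-separated in some
coordinate `k`.  The separated axis is moved to the time axis by the coordinate transposition `(0 k)` (hypercubic
invariance of the torus state, `cov_coordPerm`), then `abs_cov_le_of_axisMirror_zero`.
[cite: FrohlichIsraelLiebSimon1978, Thm. 2.1; OsterwalderSeiler1978, §2] -/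
theorem abs_cov_le_of_axisMirror {β : ℝ} (hβ : 0 ≤ β) {L R : ℕ} (hR : 1 ≤ R) (hL : 4 * R + 8 ≤ L) {B : ℝ}
    (hB : ∀ (q : Fin 4 × Fin 4) (t : ℕ), q.1 < q.2 → 2 * R + 2 ≤ t → t ≤ L →
      |torusE G r β L (fun U =>
          (plane G r q (fun i => if i = 0 then ((t : ℕ) : ℤ) else 0) U -
              torusE G r β L (plane G r q (fun i => if i = 0 then ((t : ℕ) : ℤ) else 0))) *
            (plane G r q (fun _ => 0) U - torusE G r β L (plane G r q (fun _ => 0))))| ≤ B)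
    {q q' : Fin 4 × Fin 4} (hq : q.1 < q.2) (hq' : q'.1 < q'.2) (x y : Site 4) (k : Fin 4)
    (hsep : (2 * (R : ℤ) + 4) ≤ |((((x k - y k : ℤ) : ZMod (2 * L + 1))).valMinAbs : ℤ)|) :
    |torusE G r β L (fun U => (plane G r q x U - torusE G r β L (plane G r q x)) *
        (plane G r q' y U - torusE G r β L (plane G r q' y)))| ≤ B := by
  set π : Equiv.Perm (Fin 4) := Equiv.swap 0 k with hπ
  rw [← cov_coordPerm G r β L π q q' x y]
  have hπ0 : π.symm 0 = k := by rw [hπ, Equiv.symm_swap, Equiv.swap_apply_left]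
  -- arithmetic of the cyclic gap in coordinate `k`
  haveI : NeZero (2 * L + 1) := ⟨by omega⟩
  set m : ℤ := (((x k - y k : ℤ) : ZMod (2 * L + 1))).valMinAbs with hm
  have hrange : -(L : ℤ) ≤ m ∧ m ≤ L := by
    have h2 := ZMod.valMinAbs_mem_Ioc (((x k - y k : ℤ) : ZMod (2 * L + 1)))
    rw [← hm] at h2
    obtain ⟨h2a, h2b⟩ := h2
    push_cast at h2a h2b
    constructor <;> omega
  have hdvd : ((2 * L + 1 : ℕ) : ℤ) ∣ (x k - y k) - m := by
    have h := ZMod.coe_valMinAbs (((x k - y k : ℤ) : ZMod (2 * L + 1)))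
    rw [← hm] at h
    exact (ZMod.intCast_eq_intCast_iff_dvd_sub m (x k - y k) (2 * L + 1)).mp h
  obtain ⟨w, hw⟩ := hdvd
  push_cast at hw
  rcases le_or_gt m 0 with hm0 | hm0
  · -- `y` is ahead of `x` by `g = −m`
    have habs : |m| = -m := abs_of_nonpos hm0
    obtain ⟨g, hg⟩ : ∃ g : ℕ, (g : ℤ) = -m := ⟨(-m).toNat, Int.toNat_of_nonneg (by omega)⟩
    have hg1 : 2 * R + 4 ≤ g := by
      have : (2 * (R : ℤ) + 4) ≤ (g : ℤ) := by rw [hg, ← habs]; exact hsep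
      exact_mod_cast this
    have hg2 : g ≤ L := by
      have : (g : ℤ) ≤ (L : ℤ) := by omega
      exact_mod_cast this
    exact abs_cov_le_of_axisMirror_zero G r hβ hR hL hB (permPlane_valid π hq) (permPlane_valid π hq')
      (fun i => x (π.symm i)) (fun i => y (π.symm i)) g hg1 hg2 (-w)
      (by show y (π.symm 0) = x (π.symm 0) + g + (2 * L + 1) * -w; rw [hπ0]; linarith)
  · -- `x` is ahead of `y` by `g = m`: symmetry
    have habs : |m| = m := abs_of_pos hm0
    obtain ⟨g, hg⟩ : ∃ g : ℕ, (g : ℤ) = m := ⟨m.toNat, Int.toNat_of_nonneg hm0.le⟩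
    have hg1 : 2 * R + 4 ≤ g := by
      have : (2 * (R : ℤ) + 4) ≤ (g : ℤ) := by rw [hg, ← habs]; exact hsep
      exact_mod_cast this
    have hg2 : g ≤ L := by
      have : (g : ℤ) ≤ (L : ℤ) := by omega
      exact_mod_cast this
    rw [cov_symm]
    exact abs_cov_le_of_axisMirror_zero G r hβ hR hL hB (permPlane_valid π hq') (permPlane_valid π hq)
      (fun i => y (π.symm i)) (fun i => x (π.symm i)) g hg1 hg2 w
      (by show x (π.symm 0) = y (π.symm 0) + g + (2 * L + 1) * w; rw [hπ0]; linarith)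

/-! ## §5 The route item -/

/-- **`SquareRootCeilings.MirrorDomination` (stmt-QuantumFields-26792) holds**: `AxisMirrorCeiling →
SubOnsetTwoPointCeilings`.  Given the prefix data (ε₀ and, for a live floor level ε, the constants `C, ℓ₄, β₄` of the
axis-mirror ceiling), take the SAME `C, ℓ₄` and `max β₄ 0` (reflection positivity is used at `β ≥ 0`); for a pair
cyclically `(2R+4)`-separated in coordinate `k` on a torus with `4R+8 ≤ L`, `abs_cov_le_of_axisMirror` with the ceiling
`B = (C/R⁴)²` read off `AxisMirrorCeiling` along the time axis.  No summit / leaf statement is proved; the crux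
`AxisMirrorCeiling` (stmt-QuantumFields-26791) remains open. [cite: OsterwalderSeiler1978, §2;
FrohlichIsraelLiebSimon1978, Thm. 2.1] -/
theorem squareRootCeilings_mirrorDomination_proof :
    Summit.QuantumFields.YangMills.Theses.SquareRootCeilings.MirrorDomination := by
  intro hA G _ _ _ _ hG hSU
  letI : MeasurableSpace G := borel G
  haveI : BorelSpace G := ⟨rfl⟩
  intro r v f g h Λ₅
  obtain ⟨ε₀, hε₀, hA1⟩ := hA G hG hSU r v f g h Λ₅
  refine ⟨ε₀, hε₀, fun ε hε hεε hfl => ?_⟩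
  obtain ⟨C, ℓ₄, β₄, hℓ₄, hC, hA2⟩ := hA1 ε hε hεε hfl
  refine ⟨C, ℓ₄, max β₄ 0, hℓ₄, hC, fun β hβ s hs hs1 hsub L q q' x y R hq hq' hR hRs hRL hsep => ?_⟩
  have hβ4 : β₄ ≤ β := le_trans (le_max_left _ _) hβ
  have hβ0 : (0 : ℝ) ≤ β := le_trans (le_max_right _ _) hβ
  obtain ⟨k, hk⟩ := hsep
  exact abs_cov_le_of_axisMirror G r hβ0 hR hRL
    (fun q₁ t hq₁ ht htL => hA2 β hβ4 s hs hs1 hsub L q₁ 0 R t hq₁ hR hRs hRL ht htL) hq hq' x y k hk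

end Summit.QuantumFields.YangMills.Theorems.MirrorDomination

end
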